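import Literature.Probability.RandomPlanarGeometry.SAWCountMonotoneReversal
import Literature.Probability.RandomPlanarGeometry.SAWFiniteMemoryTwo
import HarnessLib

/-!
# Monotonicity `cₙ ≤ cₙ₊₁` (O'Brien 1990): open ends — a walk ending at a strict extreme has `2d - 1`
# free extensions; the reduction to doubly trapped walks with extreme-ended targets

Sequel of `SAWCountMonotoneReversal.lean` (`doublyTrapped`, `cₙ ≤ cₙ₊₁ + #T₂`,
`count_le_count_succ_of_doublyTrapped_injOn`) and of `BDGS2012CountMonoExt.lean` (`extCount`, `freeNbrs`),
using `card_nbrs` of `SAWFiniteMemoryTwo.lean`.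

The natural targets of a repair map for the doubly trapped walks are walks whose endpoint is a STRICT
extreme point in some coordinate (for instance every Hammersley–Welsh unfolding of a tail ends beyond
the old maximum). Such an endpoint was entered by the step `+eₖ` (resp. `-eₖ`), and its `2d - 1` other
neighbours lie on or above the new extreme hyperplane, hence are unvisited:

* `extCount_eq_of_strictTop` / `extCount_eq_of_strictBot` : if `ω i k < ω n k` (resp. `>`) for all `i < n`
  then `extCount ω n = 2d - 1`;
* `extCount_zero_eq` : a `0`-step walk has `2d` free extensions;
* `count_le_count_succ_of_doublyTrapped_injOn_strictExtreme` : for `d ≥ 2`, O'Brien's inequality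
  `cₙ ≤ cₙ₊₁` follows from ANY injection of the doubly trapped `n`-step walks into the `n`-step walks
  whose endpoint is a strict maximum or a strict minimum in some coordinate.

[cite: MadrasSlade1993, §1.1, eq. (1.1.1); §3.1 (unfolding at an extreme hyperplane)] [cite: BDGS2012, §1.3]
-/

noncomputable section

open Literature.Probability.LatticeModels Literature.Probability.Percolation SimpleGraph
open scoped BigOperators

namespace Literature.Probability.RandomPlanarGeometry.SAW.Zd

variable {d : ℕ}

/-- The free extensions are among the neighbours other than the predecessor. [cite: MadrasSlade1993, §1.1] -/
theorem freeNbrs_subset_erase {n : ℕ} {ω : ℕ → Site d} [DecidableEq (Site d)] :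
    freeNbrs ω n ⊆ (nbrs (ω n)).erase (ω (n - 1)) := by
  intro y hy
  obtain ⟨ha, hne⟩ := mem_freeNbrs.1 hy
  exact Finset.mem_erase.2 ⟨fun h => hne (n - 1) (Nat.sub_le n 1) h.symm, mem_nbrs.2 ha⟩

/-- **A strict top has `2d - 1` free extensions.** If the endpoint of an `n`-step self-avoiding walk
(`n ≥ 1`) is strictly higher in coordinate `k` than every earlier site, then every neighbour of the
endpoint other than its predecessor is unvisited. [cite: MadrasSlade1993, §3.1] -/
theorem extCount_eq_of_strictTop {n : ℕ} {ω : ℕ → Site d} (hω : ω ∈ saws d n) (hn : 1 ≤ n) {k : Fin d}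
    (htop : ∀ i < n, ω i k < ω n k) : extCount ω n = 2 * d - 1 := by
  classical
  obtain ⟨-, -, hadj, -⟩ := mem_saws.1 hω
  have hpred : (zdGraph d).Adj (ω (n - 1)) (ω n) := by
    have := hadj (n - 1) (by omega); rwa [Nat.sub_add_cancel hn] at this
  have hpk : ω (n - 1) k = ω n k - 1 := by
    have h1 := abs_sub_le_one_of_adj hpred k
    have h2 := htop (n - 1) (by omega)
    rw [abs_le] at h1; omega
  have hωn : ω n = ω (n - 1) + Pi.single k 1 := (eq_add_single_of_adj' hpred.symm hpk)
  have heq : freeNbrs ω n = (nbrs (ω n)).erase (ω (n - 1)) := by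
    refine Finset.Subset.antisymm freeNbrs_subset_erase fun y hy => ?_
    obtain ⟨hne, hy⟩ := Finset.mem_erase.1 hy
    have ha := mem_nbrs.1 hy
    refine mem_freeNbrs.2 ⟨ha, fun i hi h => ?_⟩
    rcases Nat.lt_or_ge i n with hlt | hge
    · -- a visited neighbour lies strictly below, hence is `ω n - eₖ = ω (n-1)`
      have h1 := abs_sub_le_one_of_adj ha k
      have h2 := htop i hlt
      rw [abs_le] at h1
      have hyi : ω i k = y k := congrArg (fun z => z k) h
      have hyk : y k = ω n k - 1 := by omega
      have hy' : ω n = y + Pi.single k 1 := eq_add_single_of_adj' ha hyk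
      exact hne (add_right_cancel (hy'.symm.trans hωn))
    · have : i = n := by omega
      subst this
      exact ha.ne h
  rw [extCount, heq, Finset.card_erase_of_mem (mem_nbrs.2 hpred.symm), card_nbrs]

/-- **A strict bottom has `2d - 1` free extensions.** [cite: MadrasSlade1993, §3.1] -/
theorem extCount_eq_of_strictBot {n : ℕ} {ω : ℕ → Site d} (hω : ω ∈ saws d n) (hn : 1 ≤ n) {k : Fin d}
    (hbot : ∀ i < n, ω n k < ω i k) : extCount ω n = 2 * d - 1 := by
  classical
  obtain ⟨-, -, hadj, -⟩ := mem_saws.1 hω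
  have hpred : (zdGraph d).Adj (ω (n - 1)) (ω n) := by
    have := hadj (n - 1) (by omega); rwa [Nat.sub_add_cancel hn] at this
  have hpk : ω n k = ω (n - 1) k - 1 := by
    have h1 := abs_sub_le_one_of_adj hpred k
    have h2 := hbot (n - 1) (by omega)
    rw [abs_le] at h1; omega
  have hωn : ω (n - 1) = ω n + Pi.single k 1 := eq_add_single_of_adj' hpred hpk
  have heq : freeNbrs ω n = (nbrs (ω n)).erase (ω (n - 1)) := by
    refine Finset.Subset.antisymm freeNbrs_subset_erase fun y hy => ?_
    obtain ⟨hne, hy⟩ := Finset.mem_erase.1 hy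
    have ha := mem_nbrs.1 hy
    refine mem_freeNbrs.2 ⟨ha, fun i hi h => ?_⟩
    rcases Nat.lt_or_ge i n with hlt | hge
    · have h1 := abs_sub_le_one_of_adj ha k
      have h2 := hbot i hlt
      rw [abs_le] at h1
      have hyi : ω i k = y k := congrArg (fun z => z k) h
      have hyk : y k = ω n k + 1 := by omega
      have hy' : y = ω n + Pi.single k 1 := eq_add_single_of_adj ha hyk
      exact hne (hy'.trans hωn.symm)
    · have : i = n := by omega
      subst this
      exact ha.ne h
  rw [extCount, heq, Finset.card_erase_of_mem (mem_nbrs.2 hpred.symm), card_nbrs]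

/-- A `0`-step walk has all `2d` neighbours free. [cite: MadrasSlade1993, §1.1] -/
theorem extCount_zero_eq {ω : ℕ → Site d} : extCount ω 0 = 2 * d := by
  classical
  have heq : freeNbrs ω 0 = nbrs (ω 0) := by
    ext y
    rw [mem_freeNbrs, mem_nbrs]
    constructor
    · exact fun h => h.1
    · intro ha
      refine ⟨ha, fun i hi h => ?_⟩
      have : i = 0 := by omega
      subst this
      exact ha.ne h
  rw [extCount, heq, card_nbrs]

/-- **O'Brien's inequality from an injection into extreme-ended walks.** For `d ≥ 2`: if the doubly
trapped `n`-step walks can be sent injectively to `n`-step self-avoiding walks whose endpoint is a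
strict maximum or a strict minimum of some coordinate along the walk, then `cₙ ≤ cₙ₊₁` (such an
endpoint has `2d - 1 ≥ 3` free extensions, so `count_le_count_succ_of_doublyTrapped_injOn` applies).
[cite: BDGS2012, §1.3] -/
theorem count_le_count_succ_of_doublyTrapped_injOn_strictExtreme (hd : 2 ≤ d) {n : ℕ}
    (F : (ℕ → Site d) → (ℕ → Site d))
    (hF : ∀ ω ∈ doublyTrapped d n, F ω ∈ saws d n ∧
      ∃ k : Fin d, (∀ i < n, F ω i k < F ω n k) ∨ (∀ i < n, F ω n k < F ω i k))
    (hinj : Set.InjOn F (doublyTrapped d n : Set (ℕ → Site d))) :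
    count d n ≤ count d (n + 1) := by
  refine count_le_count_succ_of_doublyTrapped_injOn F (fun ω hω => ?_) hinj
  obtain ⟨hS, k, hk⟩ := hF ω hω
  refine ⟨hS, Or.inl ?_⟩
  rcases Nat.eq_zero_or_pos n with hn | hn
  · subst hn; rw [extCount_zero_eq]; omega
  · rcases hk with hk | hk
    · rw [extCount_eq_of_strictTop hS hn hk]; omega
    · rw [extCount_eq_of_strictBot hS hn hk]; omega

end Literature.Probability.RandomPlanarGeometry.SAW.Zd
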